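import Summits.BirchSwinnertonDyer.Rank1Residual.AdditivePotMult.ManinConstantDegreeValuation
import Literature.NumberTheory.EllipticCurves.Rank1Residual.Typed.SelmerCardCertificateRankZero
import HarnessLib

/-!
# Rank ONE at an additive (indeed ANY bad) odd prime: the Heegner-index valuation `≤ 1` plus the
# NATIVE `p`-descent certificate `p < #Sel^{(p)}(E/ℚ)` (cell `b2b-bsdres`, sub-cell additive-p1, gen 16)

HONEST FRAMING (cell `b2b-bsdres`, run/shared/lean/b2b/bsd-rank1-residual/, verbatim in every
file): the goal of the cell is to DELETE the COMBINATION-SHAPED residual classes of the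
Birch–Swinnerton-Dyer formula for ALL analytic-rank `≤ 1` elliptic curves over `ℚ` — "full BSD
formula for every rank `≤ 1` curve in class `C`" assembled STRICTLY from published theorems — so
that the rank-`≤ 1` remainder becomes exactly the CONSTRUCTION-SHAPED classes, which are TYPED
(missing-input `Prop`s), NOT attempted. This is not "finishing BSD". Sub-cell additive-p1 is a
RESEARCH ROUTE on the construction-shaped classes X3♯(M) / X4(M) (additive, potentially
multiplicative `p`); no claim beyond the stated sub-classes; X3/X4 labels are UNCHANGED by this file;
NOTHING is booked here (a per-pair closure is the referee's ruling on the lane's certificates).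

THEOREMS ONLY (no definition, no named fact). PER PAIR, not a class theorem.

## What this file records

Gen 13's `RankOneIrreducibleShaCertificate.lean` (p246817) reads, at a rank-one pair with `E[p]`
IRREDUCIBLE (no surjectivity), the certificate `ord_p [E(K):ℤP] ≤ 1` ∧ (ONE non-zero `x ∈ Ш(E/ℚ)` with
`p·x = 0`) ∧ unit twist value ∧ `p ∤ ∏c(E)` into `BSD(E,p) ∧ BSD(E^{d_K},p)`
(`ClassX4M.bsdp_rankOne_of_indexValuation_of_exists_torsion`; Matar–Nekovář Thm. 0.3 = cell row A91,
Gross–Zagier, Cassels–Tate). The descent engines of the cell do not print an element of `Ш`: they print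
the DIMENSION of the `p`-Selmer group, `dim_{𝔽_p} Sel^{(p)}(E/ℚ) = 3` on the rank-one `#Ш_an(E) = 9`
rows (x11c/x11b EXACT 3-descent, two exhibited exact Selmer elements beyond `E(ℚ)/3E(ℚ)`). The bridge
from that currency to the element is the tree's `Typed.exists_sha_torsion_of_pow_rank_lt_card_selmerGroup`
(pub-bsdpct, p303765: `rank E(ℚ) = r`, `p ∤ #E(ℚ)_tors`, `p^r < #Sel^{(p)}` ⇒ `∃ x ∈ Ш(E/ℚ)`, `x ≠ 0`,
`p·x = 0`), whose two side conditions are THEOREMS at such a pair: `rank E(ℚ) = 1` by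
Gross–Zagier–Kolyvagin (`hGZK`) at `r_an = 1`, and `p ∤ #E(ℚ)_tors` because `E[p]` is irreducible.
This file composes the two, so that ONE declaration takes the lane's per-row binders verbatim:

* §1 the bridge at a rank-one pair with irreducible `E[p]`:
  `exists_sha_torsion_of_rankOne_of_irr_of_lt_card_selmerGroup` (`p < #Sel^{(p)}(E/ℚ)` ⇒ the element),
  `dvd_shaOrder_of_rankOne_of_irr_of_lt_card_selmerGroup` (⇒ `p ∣ #Ш(E/ℚ)`).
* §2 class-agnostic, any odd `p ∣ N_E`, `E[p]` irreducible, Heegner field with odd `d_K < −4`: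
  `bsdp_and_bsdp_twist_of_indexValuation_of_lt_card_selmerGroup_of_odd_of_irr`.
* §3 readings: `ClassX4M.bsdp_rankOne_of_indexValuation_of_lt_card_selmerGroup` (this sub-cell; the
  19 rank-one list-B rows of REPORT §17 = the JOIN-SHA9-INDEX rank-one rows, records p245074),
  `ClassX4.bsdp_rankOne_of_indexValuation_of_lt_card_selmerGroup_of_odd` (any additive type — offer to
  additive-p2/p4 and the X7/X8/X11b rank-one `9 ∣ #Ш_an` rows with irreducible `E[p]`), and the
  Manin-free form `ClassX4M.…_of_not_dvd_modularDegree` (gen 14/15: `p ∤ deg φ` for `p ∤ c(φ)`,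
  Česnavičius–Neururer–Saha 2024 Thm. 1.2 `hCNS` + tameness of (M)).

Inputs (published, as named facts of the tree, all hypotheses): `gross_zagier` (GZ86 via CST14),
`kolyvagin` (Kolyvagin Thm. A), `MatarNekovar2019.thm03_padicValNat_card_sha_le_of_irreducible` (A91),
`rank_eq_analyticRank_of_analyticRank_le_one` (GZK), `hasEntireLFunction_rat` (modularity),
`exists_casselsTate_pairing` (Cassels 1962), and for the last theorem
`cesnaviciusNeururerSaha_padicVal_maninConstant_le_modularDegree` (A159). Kernel inputs: the PROVED
descent count `card_selmerGroup_eq_pow_rank_mul` (`#Sel^{(p)} = p^{rank}·#E(ℚ)[p]·#Ш[p]`, Silverman X.4.2).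
Missing (typed elsewhere, untouched): nothing new — per pair the certificate is finite data
(two-engine index valuation row + twist value + an EXACT `p`-descent dimension).

References: [MatarNekovar2019] Thm. 0.3, §0.11; [SilvermanAEC2009] Thm. X.4.2 (a), Thm. X.4.14;
[Miller2011LMS] Def. 1.1; [CesnaviciusNeururerSaha2023] Thm. 1.2.
-/

noncomputable section

open scoped Classical NumberField

open WeierstrassCurve NumberField Literature.NumberTheory.EllipticCurves
  Literature.NumberTheory.EllipticCurves.ModularForms
  Literature.NumberTheory.EllipticCurves.Rank1Residual
  Literature.NumberTheory.EllipticCurves.Rank1Residual.Typed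

namespace Summit.BirchSwinnertonDyer.Rank1Residual.AdditivePotMult

/-! ### §1 The bridge: `p < #Sel^{(p)}(E/ℚ)` at a rank-one pair with irreducible `E[p]` -/

/-- **The descent certificate in the engines' currency, rank one.** For `E/ℚ` with `ord_{s=1} L(E,s) = 1`
and `E[p]` irreducible, `p < #Sel^{(p)}(E/ℚ)` (i.e. `dim_{𝔽_p} Sel^{(p)}(E/ℚ) ≥ 2`) gives a non-zero
`x ∈ Ш(E/ℚ)` with `p·x = 0`. Proof: `rank E(ℚ) = 1` (Gross–Zagier–Kolyvagin `hGZK`), `p ∤ #E(ℚ)_tors`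
(irreducible `E[p]` has no rational line, `padicValNat_torsionOrder_eq_zero_of_irreducible`), then the
tree's `exists_sha_torsion_of_pow_rank_lt_card_selmerGroup` (`#Sel^{(p)} = p^{rank}·#E(ℚ)[p]·#Ш[p]`).
[cite: SilvermanAEC2009, Thm. X.4.2 (a)] [cite: Darmon2004, Thm. 3.22] -/
theorem exists_sha_torsion_of_rankOne_of_irr_of_lt_card_selmerGroup
    (W : WeierstrassCurve ℚ) [W.IsElliptic] (p : ℕ) [Fact p.Prime]
    (hGZK : rank_eq_analyticRank_of_analyticRank_le_one) (hr : W.analyticRank = 1) (hirr : Irr W p)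
    (hSel : p < Nat.card (W.selmerGroup (p : ℤ))) :
    ∃ x : W.sha, x ≠ 0 ∧ p • x = 0 := by
  have hr1 : W.analyticRank ≤ 1 := by rw [hr]
  have hrank : W.mordellWeilRank = 1 := by rw [(hGZK W hr1).1, hr]
  have htors : ¬ p ∣ W.torsionOrder := by
    intro hd
    have h0 := padicValNat_torsionOrder_eq_zero_of_irreducible W p hirr
    rw [padicValNat.eq_zero_iff] at h0
    rcases h0 with h | h | h
    · exact absurd h (Fact.out : p.Prime).one_lt.ne'
    · exact absurd h W.torsionOrder_pos_holds.ne'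
    · exact h hd
  exact exists_sha_torsion_of_pow_rank_lt_card_selmerGroup W p hrank htors (by rwa [pow_one])

/-- **Corollary: `p ∣ #Ш(E/ℚ)`** at a rank-one pair with irreducible `E[p]` and `p < #Sel^{(p)}(E/ℚ)`
(Lagrange on the element of §1, `Typed.dvd_shaOrder_of_exists_torsion`). [cite: SilvermanAEC2009, Thm. X.4.2 (a)] -/
theorem dvd_shaOrder_of_rankOne_of_irr_of_lt_card_selmerGroup
    (W : WeierstrassCurve ℚ) [W.IsElliptic] (p : ℕ) [Fact p.Prime]
    (hGZK : rank_eq_analyticRank_of_analyticRank_le_one) (hr : W.analyticRank = 1) (hirr : Irr W p)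
    (hSel : p < Nat.card (W.selmerGroup (p : ℤ))) : p ∣ W.shaOrder :=
  dvd_shaOrder_of_exists_torsion W p
    (exists_sha_torsion_of_rankOne_of_irr_of_lt_card_selmerGroup W p hGZK hr hirr hSel)

/-! ### §2 Conductor level, `p ∣ N_E` odd, `E[p]` irreducible, Heegner field with odd `d_K < -4` -/

/-- **Rank one, ANY odd `p ∣ N_E` (additive included), `E[p]` IRREDUCIBLE, Heegner field with `d_K` ODD and
`d_K < −4`: the index valuation `ord_p [E(K):ℤP] ≤ 1` and the descent certificate `p < #Sel^{(p)}(E/ℚ)`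
close BOTH the pair and its rank-zero Heegner twist at `p`** — `BSDp W p ∧ BSDp Wd p`. This is gen 13's
`bsdp_and_bsdp_twist_of_indexValuation_of_pow_dvd_of_odd_of_irr` at `k = 1` with the certificate
`p ∣ #Ш(E/ℚ)` supplied by §1 from the Selmer cardinality. Data: `Dt` a conductor-level parametrisation
datum with `p ∤ c(Dt)`, `P` its Heegner point over `K`, `Wd = Cd • W^{(d_K)}` globally minimal,
`q_d = L(Wd,1)/Ω(Wd) ≠ 0` a `p`-unit, `p ∤ ∏_ℓ c_ℓ(E)`. Per pair; nothing booked; class-agnostic.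
[cite: MatarNekovar2019, Thm. 0.3 (p. 456), §0.11 (p. 457)] [cite: SilvermanAEC2009, Thm. X.4.14]
[cite: SilvermanAEC2009, Thm. X.4.2 (a)] [cite: Miller2011LMS, Def. 1.1] -/
theorem bsdp_and_bsdp_twist_of_indexValuation_of_lt_card_selmerGroup_of_odd_of_irr
    (W : WeierstrassCurve ℚ) [W.IsElliptic] [W.IsGloballyMinimal] (p : ℕ) [Fact p.Prime]
    [NeZero (W.conductorNorm ℤ)] (K : Type) [Field K] [NumberField K]
    (Dt : ModularParametrizationData W (W.conductorNorm ℤ))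
    (H : HeegnerDatum (W.conductorNorm ℤ) (NumberField.discr K)) (ι : K →+* ℂ)
    (P : (W.baseChange K).toAffine.Point)
    -- the published inputs (named facts of the tree)
    (hGZ : gross_zagier (W.conductorNorm ℤ) W K) (hKo : kolyvagin (W.conductorNorm ℤ) W K)
    (hMN : MatarNekovar2019.thm03_padicValNat_card_sha_le_of_irreducible (W.conductorNorm ℤ) W K)
    (hGZK : rank_eq_analyticRank_of_analyticRank_le_one) (hmod : hasEntireLFunction_rat)
    (hCT : exists_casselsTate_pairing (K := ℚ))
    -- the pair and the Heegner data
    (hp2 : p ≠ 2) (hpN : p ∣ W.conductorNorm ℤ) (hr : W.analyticRank = 1) (hirr : Irr W p)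
    (hK : IsImaginaryQuadratic K) (hHN : SatisfiesHeegnerHypothesis (W.conductorNorm ℤ) K)
    (hodd : Odd (NumberField.discr K)) (hdK : NumberField.discr K < -4)
    (hP : WeierstrassCurve.Affine.Point.map ι.toRatAlgHom P = heegnerPointComplex Dt H)
    (hc : ¬ (p : ℤ) ∣ Dt.c)
    (Wd : WeierstrassCurve ℚ) [Wd.IsElliptic] [Wd.IsGloballyMinimal] (Cd : VariableChange ℚ)
    (hWd : Cd • W.quadraticTwist (NumberField.discr K : ℚ) = Wd)
    -- the twist value (a `p`-unit), `p ∤ ∏c`, and the certificate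
    (qd : ℚ) (hqd : Wd.entireLFunction 1 / (Wd.realPeriodRat : ℂ) = (qd : ℂ)) (hqd0 : qd ≠ 0)
    (hvd : padicValRat p qd = 0) (htam : ¬ p ∣ W.tamagawaProduct)
    (hI : padicValNat p (AddSubgroup.zmultiples P).index ≤ 1)
    (hSel : p < Nat.card (W.selmerGroup (p : ℤ))) :
    BSDp W p ∧ BSDp Wd p :=
  bsdp_and_bsdp_twist_of_indexValuation_of_pow_dvd_of_odd_of_irr W p K Dt H ι P hGZ hKo hMN hGZK hmod
    hCT hp2 hpN hr hirr hK hHN hodd hdK hP hc Wd Cd hWd qd hqd hqd0 hvd htam (k := 1) hI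
    (by simpa using dvd_shaOrder_of_rankOne_of_irr_of_lt_card_selmerGroup W p hGZK hr hirr hSel)

/-! ### §3 Readings: X4(M) (this sub-cell), X4 (any additive type), and the Manin-free form -/

variable {W : WeierstrassCurve ℚ} [W.IsElliptic] {p : ℕ} [Fact p.Prime]

/-- **X4(M), rank one, ANY odd `p` — NO image hypothesis: `BSD(E,p)` and `BSD(E^{d_K},p)` from the
index valuation `ord_p [E(K):ℤP] ≤ 1` at a Heegner field with odd `d_K < −4`, the unit twist value,
`p ∤ ∏c_ℓ(E)`, and the descent certificate `p < #Sel^{(p)}(E/ℚ)`** (the shape of the lane's rank-one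
`#Ш_an(E) = 9` rows at `p = 3`: two-engine `ord₃ m = 1` row of `HeegnerIndexValuationRecordsThree`
+ an EXACT 3-descent with `dim_{𝔽₃} Sel^{(3)}(E/ℚ) = 3`, i.e. `#Sel^{(3)} = 27 > 3`). `Irr W p` is part of
`ClassX4 W p`; `p ∣ N_E` because `p` is additive. Per pair; X4(M) stays CONSTRUCTION-SHAPED; nothing booked.
[cite: MatarNekovar2019, Thm. 0.3 (p. 456), §0.11 (p. 457)] [cite: SilvermanAEC2009, Thm. X.4.14]
[cite: SilvermanAEC2009, Thm. X.4.2 (a)] [cite: Miller2011LMS, Def. 1.1] -/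
theorem ClassX4M.bsdp_rankOne_of_indexValuation_of_lt_card_selmerGroup [W.IsGloballyMinimal]
    [NeZero (W.conductorNorm ℤ)]
    (hX : ClassX4M W p) (hr : W.analyticRank = 1)
    (K : Type) [Field K] [NumberField K]
    (Dt : ModularParametrizationData W (W.conductorNorm ℤ))
    (H : HeegnerDatum (W.conductorNorm ℤ) (NumberField.discr K)) (ι : K →+* ℂ)
    (P : (W.baseChange K).toAffine.Point)
    (hGZ : gross_zagier (W.conductorNorm ℤ) W K) (hKo : kolyvagin (W.conductorNorm ℤ) W K)
    (hMN : MatarNekovar2019.thm03_padicValNat_card_sha_le_of_irreducible (W.conductorNorm ℤ) W K)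
    (hGZK : rank_eq_analyticRank_of_analyticRank_le_one) (hmod : hasEntireLFunction_rat)
    (hCT : exists_casselsTate_pairing (K := ℚ))
    (hK : IsImaginaryQuadratic K) (hHN : SatisfiesHeegnerHypothesis (W.conductorNorm ℤ) K)
    (hodd : Odd (NumberField.discr K)) (hdK : NumberField.discr K < -4)
    (hP : WeierstrassCurve.Affine.Point.map ι.toRatAlgHom P = heegnerPointComplex Dt H)
    (hc : ¬ (p : ℤ) ∣ Dt.c)
    (Wd : WeierstrassCurve ℚ) [Wd.IsElliptic] [Wd.IsGloballyMinimal] (Cd : VariableChange ℚ)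
    (hWd : Cd • W.quadraticTwist (NumberField.discr K : ℚ) = Wd)
    (qd : ℚ) (hqd : Wd.entireLFunction 1 / (Wd.realPeriodRat : ℂ) = (qd : ℂ)) (hqd0 : qd ≠ 0)
    (hvd : padicValRat p qd = 0) (htam : ¬ p ∣ W.tamagawaProduct)
    (hI : padicValNat p (AddSubgroup.zmultiples P).index ≤ 1)
    (hSel : p < Nat.card (W.selmerGroup (p : ℤ))) :
    BSDp W p ∧ BSDp Wd p :=
  have hpN : p ∣ W.conductorNorm ℤ :=
    (W.dvd_conductorNorm_iff_not_hasGoodReductionAtPrime p).mpr (not_good_of_addv W p hX.1.2.1)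
  bsdp_and_bsdp_twist_of_indexValuation_of_lt_card_selmerGroup_of_odd_of_irr W p K Dt H ι P hGZ hKo hMN
    hGZK hmod hCT hX.p_ne_two hpN hr hX.irr hK hHN hodd hdK hP hc Wd Cd hWd qd hqd hqd0 hvd htam hI hSel

/-- **X4 (ANY additive type), rank one, ANY odd `p` — NO image hypothesis beyond the class's own
irreducibility: `BSD(E,p)` and `BSD(E^{d_K},p)` from the index valuation `≤ 1`, the unit twist value,
`p ∤ ∏c_ℓ(E)` and the descent certificate `p < #Sel^{(p)}(E/ℚ)`** at a Heegner field with odd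
`d_K < −4`. Class-agnostic offer (additive-p2/p4: the (G) rank-one `p² ∥ #Ш_an` rows; X7/X8/X11b
rank-one rows with `E[p]` irreducible by `bsdp_and_bsdp_twist_of_indexValuation_of_lt_card_selmerGroup_of_odd_of_irr`).
[cite: MatarNekovar2019, Thm. 0.3 (p. 456), §0.11 (p. 457)] [cite: SilvermanAEC2009, Thm. X.4.14]
[cite: SilvermanAEC2009, Thm. X.4.2 (a)] [cite: Miller2011LMS, Def. 1.1] -/
theorem ClassX4.bsdp_rankOne_of_indexValuation_of_lt_card_selmerGroup_of_odd [W.IsGloballyMinimal]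
    [NeZero (W.conductorNorm ℤ)]
    (hX : ClassX4 W p) (hr : W.analyticRank = 1)
    (K : Type) [Field K] [NumberField K]
    (Dt : ModularParametrizationData W (W.conductorNorm ℤ))
    (H : HeegnerDatum (W.conductorNorm ℤ) (NumberField.discr K)) (ι : K →+* ℂ)
    (P : (W.baseChange K).toAffine.Point)
    (hGZ : gross_zagier (W.conductorNorm ℤ) W K) (hKo : kolyvagin (W.conductorNorm ℤ) W K)
    (hMN : MatarNekovar2019.thm03_padicValNat_card_sha_le_of_irreducible (W.conductorNorm ℤ) W K)
    (hGZK : rank_eq_analyticRank_of_analyticRank_le_one) (hmod : hasEntireLFunction_rat)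
    (hCT : exists_casselsTate_pairing (K := ℚ))
    (hK : IsImaginaryQuadratic K) (hHN : SatisfiesHeegnerHypothesis (W.conductorNorm ℤ) K)
    (hodd : Odd (NumberField.discr K)) (hdK : NumberField.discr K < -4)
    (hP : WeierstrassCurve.Affine.Point.map ι.toRatAlgHom P = heegnerPointComplex Dt H)
    (hc : ¬ (p : ℤ) ∣ Dt.c)
    (Wd : WeierstrassCurve ℚ) [Wd.IsElliptic] [Wd.IsGloballyMinimal] (Cd : VariableChange ℚ)
    (hWd : Cd • W.quadraticTwist (NumberField.discr K : ℚ) = Wd)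
    (qd : ℚ) (hqd : Wd.entireLFunction 1 / (Wd.realPeriodRat : ℂ) = (qd : ℂ)) (hqd0 : qd ≠ 0)
    (hvd : padicValRat p qd = 0) (htam : ¬ p ∣ W.tamagawaProduct)
    (hI : padicValNat p (AddSubgroup.zmultiples P).index ≤ 1)
    (hSel : p < Nat.card (W.selmerGroup (p : ℤ))) :
    BSDp W p ∧ BSDp Wd p :=
  have hpN : p ∣ W.conductorNorm ℤ :=
    (W.dvd_conductorNorm_iff_not_hasGoodReductionAtPrime p).mpr (not_good_of_addv W p hX.2.1)
  bsdp_and_bsdp_twist_of_indexValuation_of_lt_card_selmerGroup_of_odd_of_irr W p K Dt H ι P hGZ hKo hMN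
    hGZK hmod hCT hX.1 hpN hr hX.2.2 hK hHN hodd hdK hP hc Wd Cd hWd qd hqd hqd0 hvd htam hI hSel

/-- **X4(M), rank one, ANY odd `p`, ANY irreducible image, NO Manin constant: `BSD(E,p) ∧ BSD(E^{(d_K)},p)`
from `ord_p [E(K):ℤP] ≤ 1`, the unit twist value, `p ∤ ∏c_ℓ(E)`, the descent certificate
`p < #Sel^{(p)}(E/ℚ)` and `p ∤ deg(Dt)`** (gen 14/15: `p ∤ deg(Dt) ⟹ p ∤ c(Dt)` on (M) by
Česnavičius–Neururer–Saha 2024 Thm. 1.2 `hCNS` + tameness `f_p = 2`; for the rank-one (M) rows with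
`9 ∣ #Ш_an` and Cremona optimality code `≥ 2`). Named facts `hGZ` `hKo` `hMN` `hGZK` `hmod` `hCT` `hCNS`.
Per pair; nothing booked. [cite: CesnaviciusNeururerSaha2023, Thm. 1.2] [cite: MatarNekovar2019, Thm. 0.3]
[cite: SilvermanAEC2009, Thm. X.4.2 (a)] [cite: Miller2011LMS, §1 and Def. 1.1] -/
theorem ClassX4M.bsdp_rankOne_of_indexValuation_of_lt_card_selmerGroup_of_not_dvd_modularDegree
    [W.IsGloballyMinimal] [NeZero (W.conductorNorm ℤ)]
    (hCNS : cesnaviciusNeururerSaha_padicVal_maninConstant_le_modularDegree)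
    (hX : ClassX4M W p) (hr : W.analyticRank = 1)
    (K : Type) [Field K] [NumberField K]
    (Dt : ModularParametrizationData W (W.conductorNorm ℤ))
    (H : HeegnerDatum (W.conductorNorm ℤ) (NumberField.discr K)) (ι : K →+* ℂ)
    (P : (W.baseChange K).toAffine.Point)
    (hGZ : gross_zagier (W.conductorNorm ℤ) W K) (hKo : kolyvagin (W.conductorNorm ℤ) W K)
    (hMN : MatarNekovar2019.thm03_padicValNat_card_sha_le_of_irreducible (W.conductorNorm ℤ) W K)
    (hGZK : rank_eq_analyticRank_of_analyticRank_le_one) (hmod : hasEntireLFunction_rat)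
    (hCT : exists_casselsTate_pairing (K := ℚ))
    (hK : IsImaginaryQuadratic K) (hHN : SatisfiesHeegnerHypothesis (W.conductorNorm ℤ) K)
    (hodd : Odd (NumberField.discr K)) (hdK : NumberField.discr K < -4)
    (hP : WeierstrassCurve.Affine.Point.map ι.toRatAlgHom P = heegnerPointComplex Dt H)
    (hdeg : ¬ p ∣ Dt.modularDegree)
    (Wd : WeierstrassCurve ℚ) [Wd.IsElliptic] [Wd.IsGloballyMinimal] (Cd : VariableChange ℚ)
    (hWd : Cd • W.quadraticTwist (NumberField.discr K : ℚ) = Wd)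
    (qd : ℚ) (hqd : Wd.entireLFunction 1 / (Wd.realPeriodRat : ℂ) = (qd : ℂ)) (hqd0 : qd ≠ 0)
    (hvd : padicValRat p qd = 0) (htam : ¬ p ∣ W.tamagawaProduct)
    (hI : padicValNat p (AddSubgroup.zmultiples P).index ≤ 1)
    (hSel : p < Nat.card (W.selmerGroup (p : ℤ))) :
    BSDp W p ∧ BSDp Wd p :=
  hX.bsdp_rankOne_of_indexValuation_of_lt_card_selmerGroup hr K Dt H ι P hGZ hKo hMN hGZK hmod hCT hK
    hHN hodd hdK hP (hX.not_dvd_maninConstant_of_not_dvd_modularDegree hCNS Dt hdeg) Wd Cd hWd qd hqd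
    hqd0 hvd htam hI hSel

end Summit.BirchSwinnertonDyer.Rank1Residual.AdditivePotMult

end
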